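import Mathlib
import Summits.CriticalPhenomena.PercolationContinuityZ3.Theorems.PercNearOneGluingNoHeavyLowerTailThreeFamilyTripleMinus
import Summits.CriticalPhenomena.PercolationContinuityZ3.Theorems.PercNearOneGluingNoHeavyLowerTailOrientedAntipodalHallCyclicMSDown

/-!
# The capacity-one Hall count for TRANSITIVE selections — Conjecture O is a theorem for all eight selections

Helper file for crux `stmt-CriticalPhenomena-4575` (`NoHeavyLowerTail`, route `PercNearOneGluingNoHeavy`),
new-inequality factory seat `prim-ineq-gen-3` (gen 10).  Everything here is PROVED.

Setting (`…OrientedAntipodalHall`): a monotone labeling `f : Finset α → Lab k` (`B < Cᵢ < A`), a ground set `S`;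
an antipodal bad of ordered type `(p,q)` is `X ⊆ S` with `f X = C_p`, `f (S \ X) = C_q`; a good set is `U ⊆ S` with
`f U = A`, `f (S \ U) = B`.  An orientation SELECTION picks one type from each opposite pair on three petals
`i, j, l`; the two cyclic selections were settled in gen 9 (`card_le_card_goods_above_cyclic_holds`, via `MS3-down`),
the six TRANSITIVE selections `(i,j), (i,l), (j,l)` are settled here:

**Theorem (`card_le_card_goods_above_transitive_holds`).**  For families `D₁, D₂, D₃` of bads of types `(i,j)`, `(i,l)`,
`(j,l)` (`i, j, l` distinct) at least `#D₁ + #D₂ + #D₃` good sets contain a member of `D₁ ∪ D₂ ∪ D₃`; equivalently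
(`exists_injective_good_above_transitive`) the bads admit DISTINCT good representatives above them.  Together with
the cyclic case this is Conjecture O (oriented `LOC-P₂`, memo COMB.md §3c (ix)) for every one of the eight
selections, with no hypothesis; classes of ≤ 2 types were gen 3/5 (T1/T2 `card_le_card_goods_above`, CHAIN).

Proof.  Work with the complements `𝒢 = {F ⊆ S : S \ F good, F misses some bad}` (down-closed) and the families
`P = {S \ X : X ∈ D₁}`, `Q = D₂` (NOT complemented), `R = {S \ Z : Z ∈ D₃}`.  All within-family differences, all
cross meets and the two outer double differences `(S \ X) \ (Y ∪ (S \ Z))`, `(S \ Z) \ ((S \ X) ∪ Y)` lie in `𝒢`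
(label bookkeeping), cross meets are nonempty and `P ∩ R = ∅` (labels `C_j ≠ C_l`); the middle double differences
`Y \ ((S \ X) ∪ (S \ Z)) = X ∩ Y ∩ Z` are in general NOT in `𝒢` — which is why the cyclic-case theorem `MS3-down`
does not apply and the two-block theorem TRIPLE⁻ (`ThreeFamilyRank.card_add_card_add_card_le_of_blocks`, gen 10) is
used instead.  (memo `run/shared/lean/prim/prim-ineq-gen-3/PROOF-TRIPLEMINUS.md`; prim-ineq-gen-3 gen 10, 2026-08-20.)
-/

namespace Summit.CriticalPhenomena.PercolationContinuityZ3.Theorems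

namespace OrientedAntipodalHall

open Finset AntipodalStrongHarris AntipodalStrongHarris.Lab ThreeFamilyRank
open scoped FinsetFamily

variable {α : Type*} [DecidableEq α] {k : ℕ}

/-- In the label order only `A` lies above `A`. -/
theorem eq_top_of_top_le {c : Lab k} (h : (top : Lab k) ≤ c) : c = top := by
  rw [le_def] at h
  rcases h with h | h | h
  · cases h
  · exact h
  · exact h.symm

/-- In the label order only `B` lies below `B`. -/
theorem eq_bot_of_le_bot {c : Lab k} (h : c ≤ (bot : Lab k)) : c = bot := by
  rw [le_def] at h
  rcases h with h | h | h
  · exact h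
  · cases h
  · exact h

omit [DecidableEq α] in
/-- Two petal-labelled sets with different petals are not nested. -/
theorem not_subset_of_petal_ne {f : Finset α → Lab k} (hf : ∀ ⦃X Y : Finset α⦄, X ⊆ Y → f X ≤ f Y)
    {X Y : Finset α} {a c : Fin k} (hX : f X = petal a) (hY : f Y = petal c) (hac : a ≠ c) : ¬ X ⊆ Y := by
  intro h
  exact hac (eq_of_petal_le_petal (by rw [← hX, ← hY]; exact hf h))

/-- Unpacking `F ⊆ (S \ A) \ (B ∪ (S \ C))` for `F ⊆ S`: `F ⊆ S \ A`, `F ⊆ S \ B` and `F ⊆ C`. -/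
theorem subset_of_subset_sdiff_union_sdiff' {S A B C F : Finset α}
    (h : F ⊆ (S \ A) \ (B ∪ (S \ C))) : F ⊆ S \ A ∧ F ⊆ S \ B ∧ F ⊆ C := by
  refine ⟨fun _ hx => (mem_sdiff.mp (h hx)).1, fun x hx => ?_, fun x hx => ?_⟩
  · have hx' := mem_sdiff.mp (h hx)
    exact mem_sdiff.mpr ⟨(mem_sdiff.mp hx'.1).1, fun hxB => hx'.2 (mem_union_left _ hxB)⟩
  · have hx' := mem_sdiff.mp (h hx)
    by_contra hxC
    exact hx'.2 (mem_union_right _ (mem_sdiff.mpr ⟨(mem_sdiff.mp hx'.1).1, hxC⟩))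

/-- Unpacking `F ⊆ (S \ A) \ ((S \ B) ∪ C)`: `F ⊆ S \ A`, `F ⊆ B` and `F ⊆ S \ C`. -/
theorem subset_of_subset_sdiff_sdiff_union {S A B C F : Finset α}
    (h : F ⊆ (S \ A) \ ((S \ B) ∪ C)) : F ⊆ S \ A ∧ F ⊆ B ∧ F ⊆ S \ C := by
  have h' : F ⊆ (S \ A) \ (C ∪ (S \ B)) := by rwa [union_comm] at h
  obtain ⟨h1, h2, h3⟩ := subset_of_subset_sdiff_union_sdiff' h'
  exact ⟨h1, h3, h2⟩

/-- **The capacity-one Hall count for transitive selections — unconditional.**  For a monotone `Lab`-labeling of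
the subsets of `S` and three families `D₁, D₂, D₃` of antipodal bads of the TRANSITIVE types `(i,j), (i,l), (j,l)`
(`i, j, l` distinct), at least `#D₁ + #D₂ + #D₃` good sets `U ⊆ S` (`f U = top`, `f (S \ U) = bot`) contain a member
of `D₁ ∪ D₂ ∪ D₃`.  (The conclusion of gen 3's `card_le_card_goods_above_transitive` with its hypothesis `hMS3` — the
instance of conjecture `MS3′` — no longer needed: the count goes through ALL co-goods and TRIPLE⁻ instead.) -/
theorem card_le_card_goods_above_transitive_holds (S : Finset α) {f : Finset α → Lab k}
    (hf : ∀ ⦃X Y : Finset α⦄, X ⊆ Y → f X ≤ f Y) (D₁ D₂ D₃ : Finset (Finset α)) {i j l : Fin k}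
    (hij : i ≠ j) (hjl : j ≠ l) (hil : i ≠ l)
    (h₁S : ∀ X ∈ D₁, X ⊆ S) (h₁i : ∀ X ∈ D₁, f X = petal i) (h₁j : ∀ X ∈ D₁, f (S \ X) = petal j)
    (h₂S : ∀ X ∈ D₂, X ⊆ S) (h₂i : ∀ X ∈ D₂, f X = petal i) (h₂l : ∀ X ∈ D₂, f (S \ X) = petal l)
    (h₃S : ∀ X ∈ D₃, X ⊆ S) (h₃j : ∀ X ∈ D₃, f X = petal j) (h₃l : ∀ X ∈ D₃, f (S \ X) = petal l) :
    #D₁ + #D₂ + #D₃ ≤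
      #{U ∈ S.powerset | f U = top ∧ f (S \ U) = bot ∧ ∃ X ∈ D₁ ∪ D₂ ∪ D₃, X ⊆ U} := by
  -- the three families: outer ones complemented, the middle one plain
  set P : Finset (Finset α) := D₁.image (S \ ·) with hPdef
  set R : Finset (Finset α) := D₃.image (S \ ·) with hRdef
  have hinj : ∀ D : Finset (Finset α), (∀ X ∈ D, X ⊆ S) → #(D.image (S \ ·)) = #D := by
    intro D hD
    apply card_image_of_injOn
    intro X hX Y hY hXY
    have e₁ := Finset.sdiff_sdiff_eq_self (hD X hX)
    have e₂ := Finset.sdiff_sdiff_eq_self (hD Y hY)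
    simp only at hXY
    rw [← e₁, ← e₂, hXY]
  have hcP : #P = #D₁ := by rw [hPdef]; exact hinj D₁ h₁S
  have hcR : #R = #D₃ := by rw [hRdef]; exact hinj D₃ h₃S
  -- the co-goods: complements of good sets above a bad
  set 𝒢 : Finset (Finset α) :=
    {F ∈ S.powerset | f (S \ F) = top ∧ f F = bot ∧ ∃ X ∈ D₁ ∪ D₂ ∪ D₃, X ⊆ S \ F} with h𝒢
  have mem₁ : ∀ X ∈ D₁, X ∈ D₁ ∪ D₂ ∪ D₃ := fun X hX => mem_union_left _ (mem_union_left _ hX)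
  have mem₂ : ∀ Y ∈ D₂, Y ∈ D₁ ∪ D₂ ∪ D₃ := fun Y hY => mem_union_left _ (mem_union_right _ hY)
  have mem₃ : ∀ Z ∈ D₃, Z ∈ D₁ ∪ D₂ ∪ D₃ := fun Z hZ => mem_union_right _ hZ
  -- certification of membership in `𝒢` from label witnesses
  have cert : ∀ {F U₁ U₂ V₁ V₂ : Finset α} {a b c d : Fin k}, F ⊆ S → a ≠ b → c ≠ d →
      f U₁ = petal a → f U₂ = petal b → U₁ ⊆ S \ F → U₂ ⊆ S \ F →
      f V₁ = petal c → f V₂ = petal d → F ⊆ V₁ → F ⊆ V₂ →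
      (∃ X ∈ D₁ ∪ D₂ ∪ D₃, X ⊆ S \ F) → F ∈ 𝒢 := by
    intro F U₁ U₂ V₁ V₂ a b c d hFS hab hcd hU₁ hU₂ h₁ h₂ hV₁ hV₂ h₃ h₄ hX
    obtain ⟨htop, hbot⟩ := good_sdiff_of_witnesses S hf hFS hab hcd hU₁ hU₂ h₁ h₂ hV₁ hV₂ h₃ h₄
    rw [Finset.sdiff_sdiff_eq_self hFS] at hbot
    rw [h𝒢, mem_filter, mem_powerset]
    exact ⟨hFS, htop, hbot, hX⟩
  have h𝒢S : ∀ E ∈ 𝒢, E ⊆ S := fun E hE => by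
    rw [h𝒢, mem_filter, mem_powerset] at hE; exact hE.1
  have h𝒢down : ∀ E ∈ 𝒢, ∀ F, F ⊆ E → F ∈ 𝒢 := by
    intro E hE F hFE
    rw [h𝒢, mem_filter, mem_powerset] at hE ⊢
    obtain ⟨hES, htop, hbot, X, hX, hXE⟩ := hE
    refine ⟨hFE.trans hES, eq_top_of_top_le ?_, eq_bot_of_le_bot ?_, X, hX,
      hXE.trans (sdiff_subset_sdiff le_rfl hFE)⟩
    · rw [← htop]; exact hf (sdiff_subset_sdiff le_rfl hFE)
    · rw [← hbot]; exact hf hFE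
  -- a bad lying inside `S \ F`
  have below : ∀ {X F : Finset α}, X ⊆ S → F ⊆ S \ X → X ⊆ S \ F :=
    fun hXS hF => subset_sdiff_of_subset_sdiff' hXS hF
  -- the block conditions
  have hPP : ∀ U ∈ P, ∀ U' ∈ P, U \ U' ∈ 𝒢 := by
    intro U hU U' hU'
    obtain ⟨X, hX, rfl⟩ := mem_image.mp hU
    obtain ⟨X', hX', rfl⟩ := mem_image.mp hU'
    obtain ⟨hFX, hFX'⟩ := subset_of_subset_sdiff_sdiff (subset_rfl : (S \ X) \ (S \ X') ⊆ _)
    have hFS : (S \ X) \ (S \ X') ⊆ S := sdiff_subset.trans sdiff_subset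
    exact cert hFS hij hij (h₁i X hX) (h₁j X' hX') (below (h₁S X hX) hFX) (sdiff_subset_sdiff le_rfl hFX')
      (h₁i X' hX') (h₁j X hX) hFX' hFX ⟨X, mem₁ X hX, below (h₁S X hX) hFX⟩
  have hQQ : ∀ Y ∈ D₂, ∀ Y' ∈ D₂, Y \ Y' ∈ 𝒢 := by
    intro Y hY Y' hY'
    have hFS : Y \ Y' ⊆ S := sdiff_subset.trans (h₂S Y hY)
    have hFY : Y \ Y' ⊆ Y := sdiff_subset
    have hFY' : Y \ Y' ⊆ S \ Y' := sdiff_subset_sdiff (h₂S Y hY) le_rfl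
    exact cert hFS hil.symm hil (h₂l Y hY) (h₂i Y' hY') (sdiff_subset_sdiff le_rfl hFY)
      (below (h₂S Y' hY') hFY') (h₂i Y hY) (h₂l Y' hY') hFY hFY' ⟨Y', mem₂ Y' hY', below (h₂S Y' hY') hFY'⟩
  have hRR : ∀ U ∈ R, ∀ U' ∈ R, U \ U' ∈ 𝒢 := by
    intro U hU U' hU'
    obtain ⟨Z, hZ, rfl⟩ := mem_image.mp hU
    obtain ⟨Z', hZ', rfl⟩ := mem_image.mp hU'
    obtain ⟨hFZ, hFZ'⟩ := subset_of_subset_sdiff_sdiff (subset_rfl : (S \ Z) \ (S \ Z') ⊆ _)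
    have hFS : (S \ Z) \ (S \ Z') ⊆ S := sdiff_subset.trans sdiff_subset
    exact cert hFS hjl hjl (h₃j Z hZ) (h₃l Z' hZ') (below (h₃S Z hZ) hFZ) (sdiff_subset_sdiff le_rfl hFZ')
      (h₃j Z' hZ') (h₃l Z hZ) hFZ' hFZ ⟨Z, mem₃ Z hZ, below (h₃S Z hZ) hFZ⟩
  have hPQ : ∀ U ∈ P, ∀ Y ∈ D₂, U ∩ Y ∈ 𝒢 ∧ (U ∩ Y).Nonempty := by
    intro U hU Y hY
    obtain ⟨X, hX, rfl⟩ := mem_image.mp hU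
    have hFX : (S \ X) ∩ Y ⊆ S \ X := inter_subset_left
    have hFY : (S \ X) ∩ Y ⊆ Y := inter_subset_right
    have hFS : (S \ X) ∩ Y ⊆ S := hFX.trans sdiff_subset
    refine ⟨cert hFS hil hij.symm (h₁i X hX) (h₂l Y hY) (below (h₁S X hX) hFX)
      (sdiff_subset_sdiff le_rfl hFY) (h₁j X hX) (h₂i Y hY) hFX hFY ⟨X, mem₁ X hX, below (h₁S X hX) hFX⟩, ?_⟩
    -- nonempty: otherwise `Y ⊆ X`, so `S \ X ⊆ S \ Y` and `C_j ≤ C_l`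
    rw [nonempty_iff_ne_empty]
    intro he
    have hYX : Y ⊆ X := by
      intro y hy
      by_contra hyX
      have : y ∈ (S \ X) ∩ Y := mem_inter.mpr ⟨mem_sdiff.mpr ⟨h₂S Y hY hy, hyX⟩, hy⟩
      rw [he] at this
      simp at this
    exact not_subset_of_petal_ne hf (h₁j X hX) (h₂l Y hY) hjl (sdiff_subset_sdiff le_rfl hYX)
  have hQR : ∀ Y ∈ D₂, ∀ U ∈ R, Y ∩ U ∈ 𝒢 ∧ (Y ∩ U).Nonempty := by
    intro Y hY U hU
    obtain ⟨Z, hZ, rfl⟩ := mem_image.mp hU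
    have hFY : Y ∩ (S \ Z) ⊆ Y := inter_subset_left
    have hFZ : Y ∩ (S \ Z) ⊆ S \ Z := inter_subset_right
    have hFS : Y ∩ (S \ Z) ⊆ S := hFZ.trans sdiff_subset
    refine ⟨cert hFS hjl.symm hil (h₂l Y hY) (h₃j Z hZ) (sdiff_subset_sdiff le_rfl hFY)
      (below (h₃S Z hZ) hFZ) (h₂i Y hY) (h₃l Z hZ) hFY hFZ ⟨Z, mem₃ Z hZ, below (h₃S Z hZ) hFZ⟩, ?_⟩
    -- nonempty: otherwise `Y ⊆ Z` and `C_i ≤ C_j`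
    rw [nonempty_iff_ne_empty]
    intro he
    have hYZ : Y ⊆ Z := by
      intro y hy
      by_contra hyZ
      have : y ∈ Y ∩ (S \ Z) := mem_inter.mpr ⟨hy, mem_sdiff.mpr ⟨h₂S Y hY hy, hyZ⟩⟩
      rw [he] at this
      simp at this
    exact not_subset_of_petal_ne hf (h₂i Y hY) (h₃j Z hZ) hij hYZ
  have hRP : ∀ U ∈ R, ∀ U' ∈ P, U ∩ U' ∈ 𝒢 ∧ (U ∩ U').Nonempty := by
    intro U hU U' hU'
    obtain ⟨Z, hZ, rfl⟩ := mem_image.mp hU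
    obtain ⟨X, hX, rfl⟩ := mem_image.mp hU'
    have hFZ : (S \ Z) ∩ (S \ X) ⊆ S \ Z := inter_subset_left
    have hFX : (S \ Z) ∩ (S \ X) ⊆ S \ X := inter_subset_right
    have hFS : (S \ Z) ∩ (S \ X) ⊆ S := hFZ.trans sdiff_subset
    exact ⟨cert hFS hij.symm hjl.symm (h₃j Z hZ) (h₁i X hX) (below (h₃S Z hZ) hFZ) (below (h₁S X hX) hFX)
      (h₃l Z hZ) (h₁j X hX) hFZ hFX ⟨X, mem₁ X hX, below (h₁S X hX) hFX⟩,
      compl_inter_compl_nonempty S hf (h₃j Z hZ) (h₃l Z hZ) (h₁i X hX) (h₁j X hX) fun h => hil h.1.symm⟩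
  have hDDP : ∀ U ∈ P, ∀ Y ∈ D₂, ∀ U' ∈ R, U \ (Y ∪ U') ∈ 𝒢 := by
    intro U hU Y hY U' hU'
    obtain ⟨X, hX, rfl⟩ := mem_image.mp hU
    obtain ⟨Z, hZ, rfl⟩ := mem_image.mp hU'
    obtain ⟨hFX, hFY, hFZ⟩ :=
      subset_of_subset_sdiff_union_sdiff' (subset_rfl : (S \ X) \ (Y ∪ (S \ Z)) ⊆ _)
    have hFS : (S \ X) \ (Y ∪ (S \ Z)) ⊆ S := sdiff_subset.trans sdiff_subset
    exact cert hFS hil hjl (h₁i X hX) (h₃l Z hZ) (below (h₁S X hX) hFX) (sdiff_subset_sdiff le_rfl hFZ)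
      (h₁j X hX) (h₂l Y hY) hFX hFY ⟨X, mem₁ X hX, below (h₁S X hX) hFX⟩
  have hDDR : ∀ U ∈ P, ∀ Y ∈ D₂, ∀ U' ∈ R, U' \ (U ∪ Y) ∈ 𝒢 := by
    intro U hU Y hY U' hU'
    obtain ⟨X, hX, rfl⟩ := mem_image.mp hU
    obtain ⟨Z, hZ, rfl⟩ := mem_image.mp hU'
    obtain ⟨hFZ, hFX, hFY⟩ :=
      subset_of_subset_sdiff_sdiff_union (subset_rfl : (S \ Z) \ ((S \ X) ∪ Y) ⊆ _)
    have hFS : (S \ Z) \ ((S \ X) ∪ Y) ⊆ S := sdiff_subset.trans sdiff_subset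
    exact cert hFS hij.symm hil.symm (h₃j Z hZ) (h₂i Y hY) (below (h₃S Z hZ) hFZ) (below (h₂S Y hY) hFY)
      (h₃l Z hZ) (h₁i X hX) hFZ hFX ⟨Z, mem₃ Z hZ, below (h₃S Z hZ) hFZ⟩
  -- no set is both a complement of a `(i,j)`-bad and of a `(j,l)`-bad
  have hdisj : ∀ U ∈ P, U ∉ R := by
    intro U hU hUR
    obtain ⟨X, hX, rfl⟩ := mem_image.mp hU
    obtain ⟨Z, hZ, hZX⟩ := mem_image.mp hUR
    have hZX' : S \ Z = S \ X := hZX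
    have h1 := h₁j X hX
    rw [← hZX', h₃l Z hZ] at h1
    exact hjl (Lab.petal.inj h1).symm
  have hPS : ∀ U ∈ P, U ⊆ S := by
    intro U hU
    obtain ⟨X, -, rfl⟩ := mem_image.mp hU
    exact sdiff_subset
  have hRS : ∀ U ∈ R, U ⊆ S := by
    intro U hU
    obtain ⟨Z, -, rfl⟩ := mem_image.mp hU
    exact sdiff_subset
  have hcount := card_add_card_add_card_le_of_blocks S 𝒢 P D₂ R h𝒢S h𝒢down hPS h₂S hRS hPP hQQ hRR hPQ
    hQR hRP hDDP hDDR hdisj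
  -- complementation is injective on `𝒢` and lands in the goods above `D₁ ∪ D₂ ∪ D₃`
  have hinj𝒢 : Set.InjOn (fun F => S \ F) (𝒢 : Set (Finset α)) := by
    intro F₁ hF₁ F₂ hF₂ h
    have e₁ := Finset.sdiff_sdiff_eq_self (h𝒢S F₁ hF₁)
    have e₂ := Finset.sdiff_sdiff_eq_self (h𝒢S F₂ hF₂)
    simp only at h
    rw [← e₁, ← e₂, h]
  have himg : 𝒢.image (fun F => S \ F) ⊆
      {U ∈ S.powerset | f U = top ∧ f (S \ U) = bot ∧ ∃ X ∈ D₁ ∪ D₂ ∪ D₃, X ⊆ U} := by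
    intro U hU
    obtain ⟨F, hF, rfl⟩ := mem_image.mp hU
    rw [h𝒢, mem_filter, mem_powerset] at hF
    obtain ⟨hFS, htop, hbot, X, hX, hXF⟩ := hF
    rw [mem_filter, mem_powerset]
    refine ⟨sdiff_subset, htop, ?_, X, hX, hXF⟩
    rw [Finset.sdiff_sdiff_eq_self hFS]; exact hbot
  calc #D₁ + #D₂ + #D₃ = #P + #D₂ + #R := by rw [hcP, hcR]
    _ ≤ #𝒢 := hcount
    _ = #(𝒢.image fun F => S \ F) := (card_image_of_injOn hinj𝒢).symm
    _ ≤ _ := card_le_card himg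

/-- **Conjecture O for transitive selections (SDR form), unconditional.**  For a monotone `Lab`-labeling and three
families of antipodal bads of the transitive types `(i,j), (i,l), (j,l)` inside `S`, there is an injective assignment
of a good set `φ X ⊇ X` (`f (φ X) = top`, `f (S \ φ X) = bot`) to every bad `X ∈ D₁ ∪ D₂ ∪ D₃`.  (With
`exists_injective_good_above_cyclic`, gen 9, every orientation selection on three petals is covered.) -/
theorem exists_injective_good_above_transitive (S : Finset α) {f : Finset α → Lab k}
    (hf : ∀ ⦃X Y : Finset α⦄, X ⊆ Y → f X ≤ f Y) (D₁ D₂ D₃ : Finset (Finset α)) {i j l : Fin k}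
    (hij : i ≠ j) (hjl : j ≠ l) (hil : i ≠ l)
    (h₁S : ∀ X ∈ D₁, X ⊆ S) (h₁i : ∀ X ∈ D₁, f X = petal i) (h₁j : ∀ X ∈ D₁, f (S \ X) = petal j)
    (h₂S : ∀ X ∈ D₂, X ⊆ S) (h₂i : ∀ X ∈ D₂, f X = petal i) (h₂l : ∀ X ∈ D₂, f (S \ X) = petal l)
    (h₃S : ∀ X ∈ D₃, X ⊆ S) (h₃j : ∀ X ∈ D₃, f X = petal j) (h₃l : ∀ X ∈ D₃, f (S \ X) = petal l) :
    ∃ φ : ↥(D₁ ∪ D₂ ∪ D₃) → Finset α, Function.Injective φ ∧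
      ∀ X : ↥(D₁ ∪ D₂ ∪ D₃), (X : Finset α) ⊆ φ X ∧ φ X ⊆ S ∧ f (φ X) = top ∧ f (S \ φ X) = bot := by
  classical
  let t : ↥(D₁ ∪ D₂ ∪ D₃) → Finset (Finset α) := fun X =>
    {U ∈ S.powerset | f U = top ∧ f (S \ U) = bot ∧ (X : Finset α) ⊆ U}
  have hHall : ∀ s : Finset ↥(D₁ ∪ D₂ ∪ D₃), #s ≤ #(s.biUnion t) := by
    intro s
    set D' : Finset (Finset α) := s.map (Function.Embedding.subtype _) with hD'
    have hD'sub : ∀ X ∈ D', X ∈ D₁ ∪ D₂ ∪ D₃ := by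
      intro X hX
      obtain ⟨x, -, rfl⟩ := mem_map.mp hX
      exact x.2
    -- split the sub-family along the three types
    set E₁ : Finset (Finset α) := D'.filter (· ∈ D₁) with hE₁
    set E₂ : Finset (Finset α) := (D'.filter (· ∉ D₁)).filter (· ∈ D₂) with hE₂
    set E₃ : Finset (Finset α) := (D'.filter (· ∉ D₁)).filter (· ∉ D₂) with hE₃
    have hE₁sub : ∀ X ∈ E₁, X ∈ D₁ := fun X hX => (mem_filter.mp hX).2
    have hE₂sub : ∀ X ∈ E₂, X ∈ D₂ := fun X hX => (mem_filter.mp hX).2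
    have hE₃sub : ∀ X ∈ E₃, X ∈ D₃ := by
      intro X hX
      obtain ⟨hX', hX2⟩ := mem_filter.mp hX
      obtain ⟨hXD', hX1⟩ := mem_filter.mp hX'
      rcases mem_union.mp (hD'sub X hXD') with h | h
      · rcases mem_union.mp h with h | h
        · exact absurd h hX1
        · exact absurd h hX2
      · exact h
    have hcard : #s = #E₁ + #E₂ + #E₃ := by
      rw [hE₁, hE₂, hE₃, add_assoc, card_filter_add_card_filter_not, card_filter_add_card_filter_not]
      exact (card_map _).symm
    have hle := card_le_card_goods_above_transitive_holds S hf E₁ E₂ E₃ hij hjl hil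
      (fun X hX => h₁S X (hE₁sub X hX)) (fun X hX => h₁i X (hE₁sub X hX))
      (fun X hX => h₁j X (hE₁sub X hX)) (fun X hX => h₂S X (hE₂sub X hX))
      (fun X hX => h₂i X (hE₂sub X hX)) (fun X hX => h₂l X (hE₂sub X hX))
      (fun X hX => h₃S X (hE₃sub X hX)) (fun X hX => h₃j X (hE₃sub X hX))
      (fun X hX => h₃l X (hE₃sub X hX))
    have hED' : ∀ X ∈ E₁ ∪ E₂ ∪ E₃, X ∈ D' := by
      intro X hX
      rcases mem_union.mp hX with h | h
      · rcases mem_union.mp h with h | h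
        · exact (mem_filter.mp h).1
        · exact (mem_filter.mp (mem_filter.mp h).1).1
      · exact (mem_filter.mp (mem_filter.mp h).1).1
    have hgoods : {U ∈ S.powerset | f U = top ∧ f (S \ U) = bot ∧ ∃ X ∈ E₁ ∪ E₂ ∪ E₃, X ⊆ U} ⊆
        s.biUnion t := by
      intro U hU
      rw [mem_filter, mem_powerset] at hU
      obtain ⟨hUS, hUtop, hUbot, X, hX, hXU⟩ := hU
      obtain ⟨x, hx, rfl⟩ := mem_map.mp (hED' X hX)
      rw [mem_biUnion]
      refine ⟨x, hx, ?_⟩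
      simp only [t, mem_filter, mem_powerset]
      exact ⟨hUS, hUtop, hUbot, hXU⟩
    calc #s = #E₁ + #E₂ + #E₃ := hcard
      _ ≤ #{U ∈ S.powerset | f U = top ∧ f (S \ U) = bot ∧ ∃ X ∈ E₁ ∪ E₂ ∪ E₃, X ⊆ U} := hle
      _ ≤ #(s.biUnion t) := card_le_card hgoods
  obtain ⟨φ, hφinj, hφ⟩ := (all_card_le_biUnion_card_iff_exists_injective t).mp hHall
  refine ⟨φ, hφinj, fun X => ?_⟩
  have hX := hφ X
  simp only [t, mem_filter, mem_powerset] at hX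
  exact ⟨hX.2.2.2, hX.1, hX.2.1, hX.2.2.1⟩

end OrientedAntipodalHall

end Summit.CriticalPhenomena.PercolationContinuityZ3.Theorems
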